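import Summits.AnomalousDissipation.AnomalousDissipation.Theorems.SteadyCoherentFractionRootsPlanarRefutation

/-!
# `RootsPlanarBeyondFiniteModes` (stmt-AnomalousDissipation-28530, residual of record R_∞ of route SteadyCoherentFraction) is FALSE

The crossed-shear root of `…RootsPlanarRefutation` has INFINITE Fourier type: `v₀ · ρ(x₂) = cos 4πx₁` pointwise, and
multiplication by `ρ = 1 + (e_(0,0,1) + e_(0,0,-1))/4` is a three-point stencil on Fourier coefficients along `x₂`
(`V0_coeff_stencil`, via the modulation rule `𝓕(e_l f)(k) = f̂(k − l)`); if the state were a.e. equal to a Fourier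
truncation `P_N`, all coefficients of `v₀` off the ball would vanish and descending the stencil along the line `(0, 2, ±j)`
from `j = N + 2` down to `j = 0` would force `𝓕(cos 4πx₁)(0,2,0) = ½` to vanish (`not_isFiniteType`). With the cylindrical
root identity and the defect bound of `…RootsPlanarRefutation`: `not_rootsPlanarBeyondFiniteModes : ¬RootsPlanarBeyondFiniteModes`.
Class refuted-SUBSTANTIVE (census E31, decomp-ad STATUS 2026-08-30T23:16:46Z, crit-certified on paper l.1223; lens-4 g22 spec
CrossedShearRoots.lean a0e7b9766f80b4f9). The finite-type half `FiniteModeRootsPlanar` (27870) is untouched.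
-/

noncomputable section

-- `Summit.<Summit>.<Problem>` is the tree's mandated summit-side namespace (CONVENTIONS §2); for this
-- single-conjunct summit the two segments coincide, so the duplicate is deliberate.
set_option linter.dupNamespace false

namespace Summit.AnomalousDissipation.AnomalousDissipation.Theorems.CrossedShearRoot

open Real MeasureTheory
open scoped InnerProductSpace
open Literature.Analysis.FunctionSpaces Literature.Analysis.FunctionSpaces.Torus Literature.Analysis.FluidPDE

/-- **Modulation rule**: `𝓕(e_l · f)(k) = 𝓕f(k − l)`. [folklore] -/
theorem mFourierCoeff_mFourier_mul (l k : Fin 3 → ℤ) (f : (UnitAddTorus (Fin 3)) → ℂ) :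
    UnitAddTorus.mFourierCoeff (fun x => UnitAddTorus.mFourier l x * f x) k = UnitAddTorus.mFourierCoeff f (k - l) := by
  rw [Torus.mFourierCoeff_eq_integral_volume, Torus.mFourierCoeff_eq_integral_volume]
  congr 1
  funext x
  simp only [smul_eq_mul, ← mul_assoc]
  rw [← UnitAddTorus.mFourier_add, show -k + l = -(k - l) by abel]

/-- Constants come out of Fourier coefficients. [folklore] -/
theorem mFourierCoeff_const_mul' (c : ℂ) (g : (UnitAddTorus (Fin 3)) → ℂ) (k : Fin 3 → ℤ) :
    UnitAddTorus.mFourierCoeff (fun x => c * g x) k = c * UnitAddTorus.mFourierCoeff g k := by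
  rw [Torus.mFourierCoeff_eq_integral_volume, Torus.mFourierCoeff_eq_integral_volume, ← integral_const_mul]
  congr 1
  funext x
  simp only [smul_eq_mul]
  ring

/-- `v₀(x) ρ(x₂) = cos(4πx₁)`. [folklore] -/
theorem V0_mul_rho (x : (UnitAddTorus (Fin 3))) : V0 x * rho (repr x 2) = c4 (repr x 1) := by
  unfold V0
  rw [div_mul_cancel₀ _ (rho_profile_pos _).1.ne']

/-- The three-point stencil: `𝓕v₀(k) + ¼𝓕v₀(k − e₂) + ¼𝓕v₀(k + e₂) = 𝓕(cos 4πx₁)(k)`, `e₂ = (0,0,1)`. [folklore] -/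
theorem V0_coeff_stencil (k : Fin 3 → ℤ) :
    UnitAddTorus.mFourierCoeff (fun x : (UnitAddTorus (Fin 3)) => (V0 x : ℂ)) k +
      (1 / 4) * UnitAddTorus.mFourierCoeff (fun x : (UnitAddTorus (Fin 3)) => (V0 x : ℂ)) (k - ![0, 0, 1]) +
      (1 / 4) * UnitAddTorus.mFourierCoeff (fun x : (UnitAddTorus (Fin 3)) => (V0 x : ℂ)) (k + ![0, 0, 1]) =
      UnitAddTorus.mFourierCoeff (fun x : (UnitAddTorus (Fin 3)) => (c4 (repr x 1) : ℂ)) k := by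
  have hV0c : Continuous fun x : (UnitAddTorus (Fin 3)) => (V0 x : ℂ) := Complex.continuous_ofReal.comp isSmooth_V0.continuous
  have hi0 : Integrable (fun x : (UnitAddTorus (Fin 3)) => (V0 x : ℂ)) volume := hV0c.integrable_unitAddTorus
  have hi1 : Integrable (fun x : (UnitAddTorus (Fin 3)) => (1 / 4 : ℂ) * (UnitAddTorus.mFourier ![0, 0, 1] x * (V0 x : ℂ))) volume :=
    (continuous_const.mul ((UnitAddTorus.mFourier ![0, 0, 1]).continuous.mul hV0c)).integrable_unitAddTorus
  have hi2 : Integrable (fun x : (UnitAddTorus (Fin 3)) => (1 / 4 : ℂ) * (UnitAddTorus.mFourier (-![0, 0, 1]) x * (V0 x : ℂ))) volume :=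
    (continuous_const.mul ((UnitAddTorus.mFourier (-![0, 0, 1])).continuous.mul hV0c)).integrable_unitAddTorus
  -- pointwise: c4 = V0 · (1 + (e + e⁻¹)/4)
  have hpt : (fun x : (UnitAddTorus (Fin 3)) => (c4 (repr x 1) : ℂ)) = (fun x : (UnitAddTorus (Fin 3)) => (V0 x : ℂ)) +
      ((fun x : (UnitAddTorus (Fin 3)) => (1 / 4 : ℂ) * (UnitAddTorus.mFourier ![0, 0, 1] x * (V0 x : ℂ))) +
        fun x : (UnitAddTorus (Fin 3)) => (1 / 4 : ℂ) * (UnitAddTorus.mFourier (-![0, 0, 1]) x * (V0 x : ℂ))) := by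
    funext x
    simp only [Pi.add_apply]
    rw [← V0_mul_rho x, Complex.ofReal_mul, rho_repr_eq 2 x]
    have h1 : UnitAddTorus.mFourier ![0, 0, 1] x = Complex.exp (2 * π * Complex.I * (repr x 2 : ℂ)) := by
      rw [mFourier_eq_prod_exp, Fin.prod_univ_three]
      simp
    have h2 : UnitAddTorus.mFourier (-![0, 0, 1]) x = (Complex.exp (2 * π * Complex.I * (repr x 2 : ℂ)))⁻¹ := by
      rw [mFourier_eq_prod_exp, Fin.prod_univ_three]
      simp
    rw [h1, h2]
    ring
  have hi12 : Integrable ((fun x : (UnitAddTorus (Fin 3)) => (1 / 4 : ℂ) * (UnitAddTorus.mFourier ![0, 0, 1] x * (V0 x : ℂ))) +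
      fun x : (UnitAddTorus (Fin 3)) => (1 / 4 : ℂ) * (UnitAddTorus.mFourier (-![0, 0, 1]) x * (V0 x : ℂ))) volume := hi1.add hi2
  rw [hpt, Torus.mFourierCoeff_add hi0 hi12, Torus.mFourierCoeff_add hi1 hi2, mFourierCoeff_const_mul',
    mFourierCoeff_const_mul', mFourierCoeff_mFourier_mul, mFourierCoeff_mFourier_mul, sub_neg_eq_add]
  ring

/-- `𝓕(cos 4πx₁)(k) = ½·[k = (0,±2,0)]`. [folklore] -/
theorem mFourierCoeff_c4 (k : Fin 3 → ℤ) :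
    UnitAddTorus.mFourierCoeff (fun x : (UnitAddTorus (Fin 3)) => (c4 (repr x 1) : ℂ)) k =
      if k ∈ ({![0, 2, 0], ![0, -2, 0]} : Finset (Fin 3 → ℤ)) then (1 / 2 : ℂ) else 0 := by
  have h : (fun x : (UnitAddTorus (Fin 3)) => (c4 (repr x 1) : ℂ)) =
      Torus.trigPoly ({![0, 2, 0], ![0, -2, 0]} : Finset (Fin 3 → ℤ)) (fun _ => (1 / 2 : ℂ)) := by
    funext x
    rw [Torus.trigPoly_apply, Finset.sum_insert (by decide), Finset.sum_singleton]
    simp only [mFourier_eq_prod_exp, Fin.prod_univ_three, Matrix.cons_val_zero, Matrix.cons_val_one,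
      Matrix.cons_val_two, Matrix.tail_cons, Matrix.head_cons, smul_eq_mul]
    rw [c4_repr_eq]
    simp only [zpow_zero, zpow_two, zpow_neg, mul_one, one_mul]
    norm_num
    ring
  rw [h, Torus.mFourierCoeff_trigPoly]

/-- **Infinite Fourier type.** No state represented by `v` is a.e. equal to one of its Fourier truncations. [folklore] -/
theorem not_isFiniteType {W : (UnitAddTorus (Fin 3)) → (EuclideanSpace ℝ (Fin 3))} (hW : W =ᵐ[volume] vfield) (N : ℕ) :
    ¬ (W =ᵐ[volume] Literature.Analysis.FunctionSpaces.Torus.fourierTruncate N W) := by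
  intro hT
  have hint : Integrable W volume := (isSmooth_vfield.integrable).congr hW.symm
  -- all coefficients of `v₀` vanish off the ball
  set a : (Fin 3 → ℤ) → ℂ := fun k => UnitAddTorus.mFourierCoeff (fun x : (UnitAddTorus (Fin 3)) => (V0 x : ℂ)) k with ha_def
  have hzero : ∀ k : Fin 3 → ℤ, k ∉ Torus.freqBall N → a k = 0 := by
    intro k hk
    have h1 : UnitAddTorus.mFourierCoeff (EuclideanSpace.complexify ∘ W) k = 0 := by
      rw [Torus.mFourierCoeff_congr_ae (hT.fun_comp EuclideanSpace.complexify) k, Torus.mFourierCoeff_fourierTruncate hint,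
        if_neg hk]
    have h2 : UnitAddTorus.mFourierCoeff (EuclideanSpace.complexify ∘ W) k =
        UnitAddTorus.mFourierCoeff (EuclideanSpace.complexify ∘ vfield) k :=
      Torus.mFourierCoeff_congr_ae (hW.fun_comp EuclideanSpace.complexify) k
    have h3 : UnitAddTorus.mFourierCoeff (EuclideanSpace.complexify ∘ vfield) k 0 = a k := by
      rw [Torus.mFourierCoeff_apply_euclidean
        ((EuclideanSpace.complexify.continuous.comp isSmooth_vfield.continuous).integrable_unitAddTorus) k 0]
      rw [ha_def]
      congr 1
      funext x
      simp [EuclideanSpace.complexify_apply, vfield]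
    rw [← h3, ← h2, h1]
    rfl
  -- the line k = (0, 2, ±j): off the ball for j ≥ N + 1
  have hoff : ∀ j : ℤ, (N : ℤ) + 1 ≤ j → (![0, 2, j] : Fin 3 → ℤ) ∉ Torus.freqBall N ∧
      (![0, 2, -j] : Fin 3 → ℤ) ∉ Torus.freqBall N := by
    intro j hj
    have hR : (N : ℝ) + 1 ≤ (j : ℝ) := by exact_mod_cast hj
    have hN : (0 : ℝ) ≤ N := Nat.cast_nonneg N
    have key : ¬ ((2 : ℝ) ^ 2 + (j : ℝ) ^ 2 ≤ (N : ℝ) ^ 2) := by nlinarith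
    constructor <;> intro hk <;> rw [Torus.mem_freqBall] at hk <;>
      simp [Torus.freqNormSq, Fin.sum_univ_three] at hk <;> exact key (by simpa using hk)
  have hlinePos : ∀ j : ℤ, (N : ℤ) + 1 ≤ j → a ![0, 2, j] = 0 := fun j hj => hzero _ (hoff j hj).1
  have hlineNeg : ∀ j : ℤ, (N : ℤ) + 1 ≤ j → a ![0, 2, -j] = 0 := fun j hj => hzero _ (hoff j hj).2
  -- the stencil along the line
  have hst : ∀ j : ℤ, a ![0, 2, j] + 1 / 4 * a ![0, 2, j - 1] + 1 / 4 * a ![0, 2, j + 1] =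
      if j = 0 then (1 / 2 : ℂ) else 0 := by
    intro j
    have h := V0_coeff_stencil ![0, 2, j]
    have e1 : (![0, 2, j] : Fin 3 → ℤ) - ![0, 0, 1] = ![0, 2, j - 1] := by
      ext i; fin_cases i <;> simp
    have e2 : (![0, 2, j] : Fin 3 → ℤ) + ![0, 0, 1] = ![0, 2, j + 1] := by
      ext i; fin_cases i <;> simp
    rw [e1, e2, mFourierCoeff_c4] at h
    rw [ha_def]
    rw [h]
    by_cases hj : j = 0
    · subst hj; simp
    · rw [if_neg hj, if_neg]
      simp only [Finset.mem_insert, Finset.mem_singleton, not_or]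
      constructor <;> intro hh <;> have h2 := congrFun hh 2 <;> simp at h2 <;> omega
  -- descent on the positive side: a(n) = a(n+1) = 0 for n = N+1 … 1
  have hpos : ∀ i : ℕ, i ≤ N → a ![0, 2, ((N : ℤ) + 1 - i)] = 0 ∧ a ![0, 2, ((N : ℤ) + 2 - i)] = 0 := by
    intro i hi
    induction i with
    | zero => exact ⟨hlinePos _ (by simp), hlinePos _ (by push_cast; linarith)⟩
    | succ i ih =>
      obtain ⟨h1, h2⟩ := ih (Nat.le_of_succ_le hi)
      refine ⟨?_, by push_cast; rw [show (N : ℤ) + 2 - (i + 1) = N + 1 - i by ring]; exact h1⟩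
      have h := hst ((N : ℤ) + 1 - i)
      have hne : ((N : ℤ) + 1 - i) ≠ 0 := by omega
      rw [if_neg hne, show (N : ℤ) + 1 - i + 1 = N + 2 - i by ring, h1, h2] at h
      push_cast
      rw [show (N : ℤ) + 1 - (i + 1) = N + 1 - i - 1 by ring]
      linear_combination (4 : ℂ) * h
  have hneg : ∀ i : ℕ, i ≤ N → a ![0, 2, -((N : ℤ) + 1 - i)] = 0 ∧ a ![0, 2, -((N : ℤ) + 2 - i)] = 0 := by
    intro i hi
    induction i with
    | zero => exact ⟨hlineNeg _ (by simp), hlineNeg _ (by push_cast; linarith)⟩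
    | succ i ih =>
      obtain ⟨h1, h2⟩ := ih (Nat.le_of_succ_le hi)
      refine ⟨?_, by push_cast; rw [show -((N : ℤ) + 2 - (i + 1)) = -(N + 1 - i) by ring]; exact h1⟩
      have h := hst (-((N : ℤ) + 1 - i))
      have hne : (-((N : ℤ) + 1 - i)) ≠ 0 := by omega
      rw [if_neg hne, show -((N : ℤ) + 1 - i) - 1 = -(N + 2 - i) by ring, h1, h2] at h
      push_cast
      rw [show -((N : ℤ) + 1 - (i + 1)) = -(N + 1 - i) + 1 by ring]
      linear_combination (4 : ℂ) * h
  obtain ⟨hp1, hp2⟩ := hpos N le_rfl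
  obtain ⟨hn1, -⟩ := hneg N le_rfl
  rw [show (N : ℤ) + 1 - N = 1 by ring] at hp1 hn1
  rw [show (N : ℤ) + 2 - N = 2 by ring] at hp2
  -- j = 1 gives a(0) = 0, then j = 0 gives 0 = 1/2
  have h1 := hst 1
  have h0 := hst 0
  norm_num at h1 h0
  rw [hp1, hp2] at h1
  rw [hn1, hp1] at h0
  have ha0 : a ![0, 2, 0] = 0 := by linear_combination (4 : ℂ) * h1
  rw [ha0] at h0
  norm_num at h0

/-- **KILL: `RootsPlanarBeyondFiniteModes` (stmt-AnomalousDissipation-28530, the residual of record R_∞ of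
SteadyCoherentFraction) is FALSE.** CLASS: refuted-SUBSTANTIVE. WITNESS: the same crossed-shear / reciprocal-shear
root `(v, c_K e₁)` (`A = 1`, `ε = 1`, `1/r = 1 + ½cos 2πx₂`, `c_K = −1/(4π)`): it is of INFINITE Fourier type
(`not_isFiniteType`: `v₀ = cos 4πx₁/ρ(x₂)` and `1/ρ` is not a trigonometric polynomial — the three-point stencil of
multiplication by `ρ` would force `𝓕(cos 4πx₁)(0,2,0) = ½` to vanish), a finite-enstrophy cylindrical steady root
(`root_identity`), and non-planar (`defect_state_ge`, defect `≥ 1/(256π²)` in every lattice direction). NO CHEAP REPAIR: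
as for `RootsPlanar` (laminar-proximity / small-enstrophy side conditions fail on the family, E31/E28b); the finite-type
half `FiniteModeRootsPlanar` (27870) is the separate, untouched item. Barrier-candidate: «reciprocal-shear modulation».
Credit: census memo NONPLANAR-ROOT-FAMILY.md d24a2b45f95a45a5, lens-4 g22 spec CrossedShearRoots.lean a0e7b9766f80b4f9. [folklore] -/
theorem not_rootsPlanarBeyondFiniteModes :
    ¬ Summit.AnomalousDissipation.AnomalousDissipation.Theses.SteadyCoherentFraction.RootsPlanarBeyondFiniteModes := by
  intro hP
  obtain ⟨W, hW, hV⟩ := exists_state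
  have hfin : Literature.Analysis.FunctionSpaces.Torus.eGradNormSq
      ((W : Lp (EuclideanSpace ℝ (Fin 3)) 2 (volume : Measure (UnitAddTorus (Fin 3)))) : (UnitAddTorus (Fin 3)) → (EuclideanSpace ℝ (Fin 3))) < ⊤ :=
    Literature.Analysis.FluidPDE.eGradNormSq_lt_top_of_memSobolev_one hV.2
  have hroot := hP drift (Literature.Analysis.FunctionSpaces.Torus.eGradNormSq
      ((W : Lp (EuclideanSpace ℝ (Fin 3)) 2 (volume : Measure (UnitAddTorus (Fin 3)))) : (UnitAddTorus (Fin 3)) → (EuclideanSpace ℝ (Fin 3)))).toReal W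
    (fun ⟨N, hN⟩ => not_isFiniteType hW N hN) (ENNReal.ofReal_toReal hfin.ne).ge
    (fun Φ => root_identity hW (Torus.CylindricalTest.isSmooth_grad_holds Φ W)
      (Torus.CylindricalTest.isDivFree_grad_holds Φ W))
  haveI : Nonempty {p : ℤ × ℤ // p ≠ 0} := ⟨⟨(1, 0), by simp⟩⟩
  have hge := le_ciInf fun p => defect_state_ge hW p
  rw [hroot] at hge
  exact absurd hge (not_le.mpr cK_sq_div_pos)

end Summit.AnomalousDissipation.AnomalousDissipation.Theorems.CrossedShearRoot

end
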